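import Literature.Analysis.ValidatedNumerics.TaylorModelZeroCert
import HarnessLib

/-!
# Nonnegativity of an exponential polynomial `p(u) + e^{−u} q(u)` on the WHOLE real line from a
# tails-and-leaves certificate

Topic `Literature/Analysis/ValidatedNumerics`; a reader-side certificate format, built entirely from this
directory's kernel-evaluable tools (`ExpPoly.Poly` coefficient lists, the straight-line programs `SOp`/`SProg`
with their Taylor-model positivity leaves `PLeaf` / `OpModel.pLeavesCheck` / `OpSem.pos_of_pLeavesCheck` of
`TaylorModelZeroCert.lean`). The target inequality

  `∀ u : ℝ, 0 ≤ p(u) + e^{−u} q(u)`,   `p, q` rational coefficient lists,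

is the per-row side condition of the scalar «KMS moment rows» of a thermal state relaxation
(`Literature/MathematicalPhysics/QuantumLattice/GibbsKMSMomentCutsSector.lean`,
`…/InfVolFermionStateTorusLimitKMSMomentCuts.lean`: hypothesis `∀ u, 0 ≤ Σ_k p_k u^k + e^{−u} Σ_k q_k u^k`),
where positivity on a bounded spectral range is NOT enough (the torus-limit object needs all of `ℝ`). A
certificate splits the line into three pieces:

* RIGHT TAIL `u ≥ R` (`expPolyLine_nonneg_of_rightTail`): with `c ≥ e^{−R}` and the shifted lists
  `sp(s) = p(R + s)`, `sq(s) = q(R + s)` (checked as identities), it suffices that `sp` and `sp + c·sq` have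
  nonnegative coefficients (then `p ≥ 0` and `p + c q ≥ 0` on the tail, and `P ≥ min(p, p + cq)` since
  `0 < e^{−u} ≤ c`);
* LEFT TAIL `u ≤ −R'` (`expPolyLine_nonneg_of_leftTail`): with `c' ≤ e^{R'}`, `sp(s) = p(−R' − s)`,
  `sq(s) = q(−R' − s)` and a polynomial minorant `T(s) ≤ e^{s}` on `s ≥ 0` with nonnegative coefficients (the
  exponential partial sums, `eval_range_inv_factorial_le_exp`), it suffices that `sq` and `sp + c'·T·sq` have
  nonnegative coefficients;
* MIDDLE `[−R', R]` (`expPolyLine_pos_of_pLeavesCheck`): the function is the straight-line program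
  `[poly p, poly q, expAff 0 (−1), mul 0 1, add 0 3]` (`toFunP_expPolyLineProg`), and a tiling of `[−R', R]` by
  positivity leaves accepted by `OpModel.slp.pLeavesCheck` (decided by the kernel) makes it positive there.

`expPolyLine_nonneg_of_pieces` assembles the three pieces; `sum_fin_getD_mul_pow_eq_eval` /
`momentRow_hyp_of_expPolyLine_nonneg` restate the conclusion in the `Fin (K+1)`-indexed coefficient form of the
moment-row theorems (`p_k = lp.getD k 0`). §5 is a worked instance: the Itoi–Ishimori–Sato–Sakamoto member
`½u²(1 + e^{−u}) − u(1 − e^{−u})` with slack `1/100·(1 + e^{−u})`, certified on all of `ℝ` with tails at `±4`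
and 32 leaves of half-width `1/8` (exact tangency at `u = 0` — a double root — is not certifiable by any outer enclosure; rows
are rounded with slack, as dual certificates always are).

Everything is PROVED; no definition, no named fact (the program and the Taylor list are written as explicit
list expressions).

## Mathlib / tree search

REUSED: `ExpPoly.Poly.eval/_add/_smul/_mul/eval_eq_sum_getD`, `PolyMP.poly_eval_map_range`,
`OpSem.slp`, `OpModel.slp`, `OpSem.pos_of_pLeavesCheck`, `toFunP_slp`, `boxMem_nil`, `tiles`, `PLeaf`
(this directory); Mathlib `Real.sum_le_exp_of_nonneg`, `Real.exp_pos`, `Real.exp_le_exp`, `Real.add_one_le_exp`.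
`lean search 'exp.*Poly.*nonneg.*line|expPolyLine'`: nothing (2026-08-27); `BernsteinRangeEnclosure.lean` is the
alternative per-leaf polynomial test (not needed here: the Taylor-model leaves handle `e^{−u}` directly).

## References

* K. Makino, M. Berz, *Taylor models and other validated functional inclusion methods*, Int. J. Pure Appl.
  Math. 4 (2003) 379–456, Algorithm 2 (verified positivity / range bounding by Taylor models on a domain
  decomposition). [cite: MakinoBerz2003, Algorithm 2]
* G. Melquiond, *Proving bounds on real-valued functions with computations*, IJCAR 2008, LNCS 5195, 2–17,
  Sect. 3.3 (straight-line programs). [cite: Melquiond2008, Sect. 3.3]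
* C. Itoi, H. Ishimori, K. Sato, Y. Sakamoto, J. Phys. Soc. Jpn. 92 (2023) 074001 = arXiv:2306.03489, Thm. 3
  and Lemma 6 (sign-definite exponential polynomials of the series correlation inequalities). [cite: ItoiEtAl2023, Lemma 6]
-/

noncomputable section

namespace Literature.Analysis.ValidatedNumerics

open Set PolyMP ExpPoly ExpPoly.Poly
open Literature.Analysis.ValidatedNumerics.NumericsMP

/-! ### §1 Coefficientwise-nonnegative lists are nonnegative on `[0, ∞)` -/

/-- A coefficient list with nonnegative entries evaluates to a nonnegative number at every `s ≥ 0` (the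
half-line test of a tail certificate). [cite: MakinoBerz2003, Algorithm 2] -/
theorem poly_eval_nonneg_of_forall_mem_nonneg : ∀ (p : Poly), (∀ a ∈ p, (0 : ℚ) ≤ a) →
    ∀ {s : ℝ}, 0 ≤ s → 0 ≤ Poly.eval p s
  | [], _, _, _ => by simp
  | a :: p, h, s, hs => by
    rw [Poly.eval_cons]
    have ha : (0 : ℝ) ≤ (a : ℝ) := by exact_mod_cast h a (by simp)
    exact add_nonneg ha (mul_nonneg hs (poly_eval_nonneg_of_forall_mem_nonneg p
      (fun b hb => h b (List.mem_cons_of_mem a hb)) hs))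

/-- The exponential partial sums as a coefficient list: `eval ((range J).map (1/j!)) s = Σ_{j<J} s^j/j! ≤ e^s`
for `s ≥ 0` (Mathlib `Real.sum_le_exp_of_nonneg`). [cite: MakinoBerz2003, Algorithm 2] -/
theorem eval_range_inv_factorial_le_exp (J : ℕ) {s : ℝ} (hs : 0 ≤ s) :
    Poly.eval ((List.range J).map fun j => (1 : ℚ) / (j.factorial : ℚ)) s ≤ Real.exp s := by
  rw [poly_eval_map_range]
  have h := Real.sum_le_exp_of_nonneg hs J
  refine le_of_eq_of_le (Finset.sum_congr rfl fun j _ => ?_) h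
  push_cast
  rw [div_eq_mul_inv, one_mul, mul_comm, div_eq_mul_inv]

/-- The entries of the exponential partial-sum list are nonnegative. [cite: MakinoBerz2003, Algorithm 2] -/
theorem forall_mem_range_inv_factorial_nonneg (J : ℕ) :
    ∀ a ∈ (List.range J).map (fun j => (1 : ℚ) / (j.factorial : ℚ)), (0 : ℚ) ≤ a := by
  intro a ha
  obtain ⟨j, -, rfl⟩ := List.mem_map.1 ha
  positivity

/-! ### §2 The two tails -/

/-- **Right-tail certificate.** Let `c ≥ e^{−R}`, `sp(s) = p(R + s)`, `sq(s) = q(R + s)` (shifted coefficient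
lists, supplied by the certificate and checked as identities), and suppose `sp` and `sp + c·sq` have nonnegative
coefficients. Then `0 ≤ p(u) + e^{−u} q(u)` for every `u ≥ R` (on the tail `p ≥ 0`, `p + cq ≥ 0` and
`0 < e^{−u} ≤ c`, so `p + e^{−u}q ≥ min(p, p + cq)`). [cite: MakinoBerz2003, Algorithm 2] -/
theorem expPolyLine_nonneg_of_rightTail {lp lq sp sq : Poly} {R c : ℚ} (hc : Real.exp (-(R : ℝ)) ≤ c)
    (hsp : ∀ s : ℝ, Poly.eval sp s = Poly.eval lp ((R : ℝ) + s))
    (hsq : ∀ s : ℝ, Poly.eval sq s = Poly.eval lq ((R : ℝ) + s))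
    (h1 : ∀ a ∈ sp, (0 : ℚ) ≤ a) (h2 : ∀ a ∈ Poly.add sp (Poly.smul c sq), (0 : ℚ) ≤ a)
    {u : ℝ} (hu : (R : ℝ) ≤ u) : 0 ≤ Poly.eval lp u + Real.exp (-u) * Poly.eval lq u := by
  have hs : 0 ≤ u - R := sub_nonneg.2 hu
  have hp : 0 ≤ Poly.eval lp u := by
    have h := poly_eval_nonneg_of_forall_mem_nonneg sp h1 hs
    rwa [hsp, add_sub_cancel] at h
  have hpq : 0 ≤ Poly.eval lp u + (c : ℝ) * Poly.eval lq u := by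
    have h := poly_eval_nonneg_of_forall_mem_nonneg _ h2 hs
    rwa [Poly.eval_add, Poly.eval_smul, hsp, hsq, add_sub_cancel] at h
  have hexp : Real.exp (-u) ≤ c := (Real.exp_le_exp.2 (by linarith)).trans hc
  rcases le_or_gt 0 (Poly.eval lq u) with hq | hq
  · exact add_nonneg hp (mul_nonneg (Real.exp_pos _).le hq)
  · have : (c : ℝ) * Poly.eval lq u ≤ Real.exp (-u) * Poly.eval lq u :=
      mul_le_mul_of_nonpos_right hexp hq.le
    linarith

/-- **Left-tail certificate.** Let `c' ≤ e^{R'}`, `sp(s) = p(−R' − s)`, `sq(s) = q(−R' − s)`, `T` a coefficient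
list with nonnegative entries and `T(s) ≤ e^{s}` for `s ≥ 0` (e.g. the exponential partial sums), and suppose `sq`
and `sp + c'·T·sq` have nonnegative coefficients. Then `0 ≤ p(u) + e^{−u} q(u)` for every `u ≤ −R'` (on the tail
`q ≥ 0` and `e^{−u} = e^{R'} e^{s} ≥ c' T(s)`, `s = −R' − u ≥ 0`). [cite: MakinoBerz2003, Algorithm 2] -/
theorem expPolyLine_nonneg_of_leftTail {lp lq sp sq T : Poly} {R' c' : ℚ} (hc' : (c' : ℝ) ≤ Real.exp R')
    (hsp : ∀ s : ℝ, Poly.eval sp s = Poly.eval lp (-(R' : ℝ) - s))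
    (hsq : ∀ s : ℝ, Poly.eval sq s = Poly.eval lq (-(R' : ℝ) - s))
    (hT : ∀ s : ℝ, 0 ≤ s → Poly.eval T s ≤ Real.exp s) (hT0 : ∀ a ∈ T, (0 : ℚ) ≤ a)
    (h1 : ∀ a ∈ sq, (0 : ℚ) ≤ a) (h2 : ∀ a ∈ Poly.add sp (Poly.smul c' (Poly.mul T sq)), (0 : ℚ) ≤ a)
    {u : ℝ} (hu : u ≤ -(R' : ℝ)) : 0 ≤ Poly.eval lp u + Real.exp (-u) * Poly.eval lq u := by
  set s : ℝ := -(R' : ℝ) - u with hs_def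
  have hs : 0 ≤ s := by rw [hs_def]; linarith
  have hus : u = -(R' : ℝ) - s := by rw [hs_def]; ring
  have hq : 0 ≤ Poly.eval lq u := by
    have h := poly_eval_nonneg_of_forall_mem_nonneg sq h1 hs
    rwa [hsq, ← hus] at h
  have hTs : 0 ≤ Poly.eval T s := poly_eval_nonneg_of_forall_mem_nonneg T hT0 hs
  have hmain : 0 ≤ Poly.eval lp u + (c' : ℝ) * (Poly.eval T s * Poly.eval lq u) := by
    have h := poly_eval_nonneg_of_forall_mem_nonneg _ h2 hs
    rwa [Poly.eval_add, Poly.eval_smul, Poly.eval_mul, hsp, hsq, ← hus] at h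
  -- `c' T(s) ≤ e^{R'} e^{s} = e^{-u}`
  have hexp : (c' : ℝ) * Poly.eval T s ≤ Real.exp (-u) := by
    have h1' : (c' : ℝ) * Poly.eval T s ≤ Real.exp R' * Real.exp s :=
      mul_le_mul hc' (hT s hs) hTs (Real.exp_pos _).le
    rwa [← Real.exp_add, show (R' : ℝ) + s = -u by rw [hus]; ring] at h1'
  have : (c' : ℝ) * (Poly.eval T s * Poly.eval lq u) ≤ Real.exp (-u) * Poly.eval lq u := by
    rw [← mul_assoc]
    exact mul_le_mul_of_nonneg_right hexp hq
  linarith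

/-! ### §3 The middle: the exponential polynomial as a straight-line program, positivity leaves -/

/-- **The straight-line program of `p(t) + e^{−t} q(t)`**: `[poly p, poly q, expAff 0 (−1), mul 0 1, add 0 3]`
(push `p`, push `q`, push `e^{0 − t}`, multiply the two most recent, add the product to `p`) denotes
`t ↦ p(t) + e^{−t} q(t)`. [cite: Melquiond2008, Sect. 3.3] -/
theorem toFunP_expPolyLineProg (lp lq : Poly) (t : ℝ) :
    SProg.toFunP [SOp.poly lp, SOp.poly lq, SOp.expAff 0 (-1), SOp.mul 0 1, SOp.add 0 3] [] t =
      Poly.eval lp t + Real.exp (-t) * Poly.eval lq t := by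
  simp [SProg.toFunP, constStack, SProg.runF, SOp.evalF, getReg]
  ring

/-- **Positivity of `p + e^{−·} q` on a tiled interval from Taylor-model leaves.** If the leaves `P` tile `[x, y]`
(`tiles`) and every leaf is accepted by `OpModel.slp.pLeavesCheck` for the program of `toFunP_expPolyLineProg`
(scale `S > 0`, modeller parameters `prm`; decided by the kernel), then `0 < p(t) + e^{−t} q(t)` on `[x, y]`.
[cite: MakinoBerz2003, Algorithm 2] [cite: Melquiond2008, Sect. 3.3] -/
theorem expPolyLine_pos_of_pLeavesCheck {lp lq : Poly} {prm : SlpPrm} {S : ℕ} (hS : 0 < S)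
    {P : List PLeaf} {x y : ℚ} (hxy : x < y) (ht : tiles x (P.map fun l => (l.e, l.k)) y = true)
    (hc : OpModel.slp.pLeavesCheck prm S
      [SOp.poly lp, SOp.poly lq, SOp.expAff 0 (-1), SOp.mul 0 1, SOp.add 0 3] [] P = true)
    {t : ℝ} (ht1 : (x : ℝ) ≤ t) (ht2 : t ≤ (y : ℝ)) :
    0 < Poly.eval lp t + Real.exp (-t) * Poly.eval lq t := by
  obtain ⟨-, h⟩ := OpSem.slp.pos_of_pLeavesCheck (prm := prm) hS boxMem_nil P x y ht hc
  have h' := h hxy t ⟨ht1, ht2⟩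
  rwa [toFunP_slp, toFunP_expPolyLineProg] at h'

/-! ### §4 Assembly, and the coefficient-function form of the moment-row hypothesis -/

/-- **The whole-line certificate.** Nonnegativity on the left tail `u ≤ −R'`, positivity on the tiled middle
`[−R', R]` and nonnegativity on the right tail `u ≥ R` give `0 ≤ p(u) + e^{−u} q(u)` for every real `u`.
[cite: MakinoBerz2003, Algorithm 2] -/
theorem expPolyLine_nonneg_of_pieces {lp lq : Poly} {R' R : ℚ}
    (hleft : ∀ u : ℝ, u ≤ -(R' : ℝ) → 0 ≤ Poly.eval lp u + Real.exp (-u) * Poly.eval lq u)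
    (hmid : ∀ u : ℝ, ((-R' : ℚ) : ℝ) ≤ u → u ≤ (R : ℝ) → 0 < Poly.eval lp u + Real.exp (-u) * Poly.eval lq u)
    (hright : ∀ u : ℝ, (R : ℝ) ≤ u → 0 ≤ Poly.eval lp u + Real.exp (-u) * Poly.eval lq u) (u : ℝ) :
    0 ≤ Poly.eval lp u + Real.exp (-u) * Poly.eval lq u := by
  rcases le_or_gt u (-(R' : ℝ)) with h | h
  · exact hleft u h
  rcases le_or_gt (R : ℝ) u with h' | h'
  · exact hright u h'
  exact (hmid u (by push_cast; exact h.le) h'.le).le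

/-- **Coefficient lists versus `Fin (K+1)`-indexed coefficients**: for a list of length `≤ K + 1`,
`Σ_{k : Fin (K+1)} lp[k] u^k = eval lp u` (`lp[k] = lp.getD k 0`). [cite: ItoiEtAl2023, Lemma 6] -/
theorem sum_fin_getD_mul_pow_eq_eval {K : ℕ} (lp : Poly) (hlen : lp.length ≤ K + 1) (u : ℝ) :
    ∑ k : Fin (K + 1), ((lp.getD (k : ℕ) 0 : ℚ) : ℝ) * u ^ (k : ℕ) = Poly.eval lp u := by
  rw [Poly.eval_eq_sum_getD, Fin.sum_univ_eq_sum_range (fun k => ((lp.getD k 0 : ℚ) : ℝ) * u ^ k) (K + 1)]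
  obtain ⟨e, he⟩ := Nat.exists_eq_add_of_le hlen
  rw [he, Finset.sum_range_add, add_eq_left]
  refine Finset.sum_eq_zero fun j _ => ?_
  rw [List.getD_eq_default _ _ (by omega), Rat.cast_zero, zero_mul]

/-- **The moment-row hypothesis from a line certificate**: if `0 ≤ eval lp u + e^{−u} eval lq u` for all `u` and
both lists have length `≤ K + 1`, then the coefficient functions `p k = lp[k]`, `q k = lq[k]` satisfy
`∀ u, 0 ≤ Σ_k p_k u^k + e^{−u} Σ_k q_k u^k` — the hypothesis `hpq` of
`sum_exp_mul_re_expect_momentRow_nonneg` / `IsTorusLimitOfMixture.re_expect_momentRow_nonneg_of_sectorGibbs`.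
[cite: ItoiEtAl2023, Theorem 3] -/
theorem momentRow_hyp_of_expPolyLine_nonneg {K : ℕ} {lp lq : Poly} (hp : lp.length ≤ K + 1)
    (hq : lq.length ≤ K + 1) (h : ∀ u : ℝ, 0 ≤ Poly.eval lp u + Real.exp (-u) * Poly.eval lq u) (u : ℝ) :
    0 ≤ ∑ k : Fin (K + 1), ((lp.getD (k : ℕ) 0 : ℚ) : ℝ) * u ^ (k : ℕ) +
      Real.exp (-u) * ∑ k : Fin (K + 1), ((lq.getD (k : ℕ) 0 : ℚ) : ℝ) * u ^ (k : ℕ) := by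
  rw [sum_fin_getD_mul_pow_eq_eval lp hp, sum_fin_getD_mul_pow_eq_eval lq hq]
  exact h u

/-! ### §5 Worked instance: the Itoi–Ishimori–Sato–Sakamoto member with slack -/

/-- **Example certificate**: `P(u) = (1/100 − u + ½u²) + e^{−u}(1/100 + u + ½u²)` — Itoi et al. Thm. 3
(`n = 0`) row `½u²(1 + e^{−u}) − u(1 − e^{−u})` plus the slack `(1 + e^{−u})/100` — is nonnegative on the whole
line: tails at `R = R' = 4` with `c = c' = 1`, `T = Σ_{j<2} s^j/j!`, and the middle `[−4, 4]` tiled by 32 leaves of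
half-width `1/8` (scale `2^30`, Taylor degree 8), decided by the kernel. (Exact tangency rows — here `u = 0` would be
a double root without the slack — are not certifiable by outer enclosures; dual rows are rounded with slack.)
[cite: ItoiEtAl2023, Theorem 3] -/
theorem expPolyLine_nonneg_itoi_slack (u : ℝ) :
    0 ≤ Poly.eval [1/100, -1, 1/2] u + Real.exp (-u) * Poly.eval [1/100, 1, 1/2] u := by
  refine expPolyLine_nonneg_of_pieces (R' := 4) (R := 4) ?_ ?_ ?_ u
  · intro v hv
    refine expPolyLine_nonneg_of_leftTail (sp := [1201/100, 5, 1/2]) (sq := [401/100, 3, 1/2])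
      (T := (List.range 2).map fun j => (1 : ℚ) / (j.factorial : ℚ)) (c' := 1) ?_
      (fun s => ?_) (fun s => ?_) (fun s hs => eval_range_inv_factorial_le_exp 2 hs)
      (forall_mem_range_inv_factorial_nonneg 2) (by decide +kernel) (by decide +kernel) hv
    · have h := Real.add_one_le_exp ((4 : ℚ) : ℝ); push_cast at h ⊢; linarith
    · simp only [Poly.eval_cons, Poly.eval_nil]; push_cast; ring
    · simp only [Poly.eval_cons, Poly.eval_nil]; push_cast; ring
  · intro v hv1 hv2
    exact expPolyLine_pos_of_pLeavesCheck (prm := ⟨8, 10, 12, 4, 0⟩) (S := 2 ^ 30) (by norm_num)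
      (P := [⟨-31/8, 1/8, []⟩, ⟨-29/8, 1/8, []⟩, ⟨-27/8, 1/8, []⟩, ⟨-25/8, 1/8, []⟩,
        ⟨-23/8, 1/8, []⟩, ⟨-21/8, 1/8, []⟩, ⟨-19/8, 1/8, []⟩, ⟨-17/8, 1/8, []⟩,
        ⟨-15/8, 1/8, []⟩, ⟨-13/8, 1/8, []⟩, ⟨-11/8, 1/8, []⟩, ⟨-9/8, 1/8, []⟩,
        ⟨-7/8, 1/8, []⟩, ⟨-5/8, 1/8, []⟩, ⟨-3/8, 1/8, []⟩, ⟨-1/8, 1/8, []⟩,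
        ⟨1/8, 1/8, []⟩, ⟨3/8, 1/8, []⟩, ⟨5/8, 1/8, []⟩, ⟨7/8, 1/8, []⟩,
        ⟨9/8, 1/8, []⟩, ⟨11/8, 1/8, []⟩, ⟨13/8, 1/8, []⟩, ⟨15/8, 1/8, []⟩,
        ⟨17/8, 1/8, []⟩, ⟨19/8, 1/8, []⟩, ⟨21/8, 1/8, []⟩, ⟨23/8, 1/8, []⟩,
        ⟨25/8, 1/8, []⟩, ⟨27/8, 1/8, []⟩, ⟨29/8, 1/8, []⟩, ⟨31/8, 1/8, []⟩])
      (x := -4) (y := 4) (by norm_num) (by decide +kernel) (by decide +kernel) (by simpa using hv1) hv2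
  · intro v hv
    refine expPolyLine_nonneg_of_rightTail (sp := [401/100, 3, 1/2]) (sq := [1201/100, 5, 1/2]) (c := 1)
      ?_ (fun s => ?_) (fun s => ?_) (by decide +kernel) (by decide +kernel) hv
    · have h := Real.exp_le_exp.2 (show -((4 : ℚ) : ℝ) ≤ 0 by norm_num)
      rw [Real.exp_zero] at h; exact_mod_cast h
    · simp only [Poly.eval_cons, Poly.eval_nil]; push_cast; ring
    · simp only [Poly.eval_cons, Poly.eval_nil]; push_cast; ring

/-! ### §6 Robust tails: large rational constants `2^j ≤ e^{R'}`, `e^{−R} ≤ 2^{−j}`, and a right tail that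
tolerates a higher-degree `q` -/

/-- `2^j ≤ e^R` for `j ≤ R` (since `2 ≤ e`): the rational constant `c' = 2^j` of a left-tail certificate.
[cite: MakinoBerz2003, Algorithm 2] -/
theorem two_pow_le_exp_of_natCast_le {j : ℕ} {R : ℝ} (h : (j : ℝ) ≤ R) : (2 : ℝ) ^ j ≤ Real.exp R := by
  have h2 : (2 : ℝ) ≤ Real.exp 1 := by linarith [Real.add_one_le_exp (1 : ℝ)]
  calc (2 : ℝ) ^ j ≤ (Real.exp 1) ^ j := pow_le_pow_left₀ (by norm_num) h2 j
    _ = Real.exp (j : ℝ) := by rw [← Real.exp_nat_mul, mul_one]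
    _ ≤ Real.exp R := Real.exp_le_exp.2 h

/-- `e^{−R} ≤ 1/2^j` for `j ≤ R`: the rational constant `c = 1/2^j` of a right-tail certificate.
[cite: MakinoBerz2003, Algorithm 2] -/
theorem exp_neg_le_one_div_two_pow_of_natCast_le {j : ℕ} {R : ℝ} (h : (j : ℝ) ≤ R) :
    Real.exp (-R) ≤ 1 / (2 : ℝ) ^ j := by
  rw [Real.exp_neg, ← one_div]
  exact one_div_le_one_div_of_le (by positivity) (two_pow_le_exp_of_natCast_le h)

/-- Absolute values of a coefficient list bound its values: `|eval p u| ≤ eval |p| u` for `u ≥ 0`.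
[cite: MakinoBerz2003, Algorithm 2] -/
theorem abs_poly_eval_le_eval_map_abs : ∀ (p : Poly) {u : ℝ}, 0 ≤ u →
    |Poly.eval p u| ≤ Poly.eval (p.map fun a => |a|) u
  | [], _, _ => by simp
  | a :: p, u, hu => by
    rw [List.map_cons, Poly.eval_cons, Poly.eval_cons]
    have ih := abs_poly_eval_le_eval_map_abs p hu
    calc |(a : ℝ) + u * Poly.eval p u| ≤ |(a : ℝ)| + |u * Poly.eval p u| := abs_add_le _ _
      _ = |(a : ℝ)| + u * |Poly.eval p u| := by rw [abs_mul, abs_of_nonneg hu]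
      _ ≤ ((|a| : ℚ) : ℝ) + u * Poly.eval (p.map fun a => |a|) u := by
          push_cast
          exact add_le_add le_rfl (mul_le_mul_of_nonneg_left ih hu)

/-- On `u ≥ R ≥ 1`: `e^{−u} · eval |q| u ≤ N! · eval |q| R / R^N` whenever `q` has at most `N + 1` coefficients
(`u^k e^{−u} ≤ N! u^{k−N} ≤ N! R^{k−N}` for `k ≤ N`, Mathlib `Real.pow_div_factorial_le_exp`).
[cite: MakinoBerz2003, Algorithm 2] -/
theorem exp_neg_mul_eval_map_abs_le : ∀ (q : Poly) {N : ℕ}, q.length ≤ N + 1 → ∀ {R u : ℝ}, 1 ≤ R → R ≤ u →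
    Real.exp (-u) * Poly.eval (q.map fun a => |a|) u ≤
      (N.factorial : ℝ) * Poly.eval (q.map fun a => |a|) R / R ^ N := by
  intro q N hN R u hR hRu
  have hu0 : 0 < u := by linarith
  have hR0 : 0 < R := by linarith
  rw [Poly.eval_eq_sum_getD, Poly.eval_eq_sum_getD, List.length_map, Finset.mul_sum, Finset.mul_sum,
    Finset.sum_div]
  refine Finset.sum_le_sum fun k hk => ?_
  have hkN : k ≤ N := by have := Finset.mem_range.1 hk; omega
  have hq0 : (0 : ℝ) ≤ (((q.map fun a => |a|).getD k 0 : ℚ) : ℝ) := by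
    rw [List.getD_eq_getElem?_getD, List.getElem?_map]
    cases q[k]? with
    | none => simp
    | some a => simp [abs_nonneg]
  -- `e^{-u} u^k ≤ N! / u^{N-k} ≤ N! / R^{N-k} = N! R^k / R^N`
  have hexp : Real.exp (-u) * u ^ k ≤ (N.factorial : ℝ) * R ^ k / R ^ N := by
    have h1 : u ^ N / (N.factorial : ℝ) ≤ Real.exp u := Real.pow_div_factorial_le_exp u hu0.le N
    have hfac : (0 : ℝ) < N.factorial := by exact_mod_cast Nat.factorial_pos N
    have h2 : Real.exp (-u) * u ^ N ≤ N.factorial := by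
      rw [Real.exp_neg]
      rw [div_le_iff₀ hfac] at h1
      have := (inv_mul_le_iff₀ (Real.exp_pos u)).2 (by linarith : u ^ N ≤ Real.exp u * N.factorial)
      exact this
    -- multiply by `u^k / u^N ≤ R^k / R^N`
    have h3 : Real.exp (-u) * u ^ k = (Real.exp (-u) * u ^ N) * (u ^ k / u ^ N) := by
      field_simp
    have h4 : u ^ k / u ^ N ≤ R ^ k / R ^ N := by
      rw [div_le_div_iff₀ (pow_pos hu0 N) (pow_pos hR0 N)]
      obtain ⟨e, rfl⟩ := Nat.exists_eq_add_of_le hkN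
      rw [pow_add, pow_add, ← mul_assoc, ← mul_assoc, mul_comm (u ^ k) (R ^ k)]
      exact mul_le_mul_of_nonneg_left (pow_le_pow_left₀ hR0.le hRu e) (by positivity)
    rw [h3]
    calc Real.exp (-u) * u ^ N * (u ^ k / u ^ N) ≤ (N.factorial : ℝ) * (R ^ k / R ^ N) :=
          mul_le_mul h2 h4 (by positivity) (by positivity)
      _ = (N.factorial : ℝ) * R ^ k / R ^ N := by ring
  calc Real.exp (-u) * ((((q.map fun a => |a|).getD k 0 : ℚ) : ℝ) * u ^ k)
      = (((q.map fun a => |a|).getD k 0 : ℚ) : ℝ) * (Real.exp (-u) * u ^ k) := by ring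
    _ ≤ (((q.map fun a => |a|).getD k 0 : ℚ) : ℝ) * ((N.factorial : ℝ) * R ^ k / R ^ N) :=
        mul_le_mul_of_nonneg_left hexp hq0
    _ = (N.factorial : ℝ) * ((((q.map fun a => |a|).getD k 0 : ℚ) : ℝ) * R ^ k) / R ^ N := by ring

/-- **Robust right-tail certificate** (for rows whose `q` has higher degree than `p` or negative coefficients far
out): let `R ≥ 1`, `q` of length `≤ N + 1`, `ε` a rational with `N! · |q|(R) ≤ ε · R^N` (`|q|` = coefficientwise
absolute values, `Poly.evalQ`), and `sp(s) = p(R + s)` with `sp − [ε]` coefficientwise nonnegative. Then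
`0 ≤ p(u) + e^{−u} q(u)` for every `u ≥ R` (there `|e^{−u} q(u)| ≤ ε ≤ p(u)`). [cite: MakinoBerz2003, Algorithm 2] -/
theorem expPolyLine_nonneg_of_rightTail_robust {lp lq sp : Poly} {R ε : ℚ} {N : ℕ} (hR : 1 ≤ R)
    (hN : lq.length ≤ N + 1)
    (hε : (N.factorial : ℚ) * Poly.evalQ (lq.map fun a => |a|) R ≤ ε * R ^ N)
    (hsp : ∀ s : ℝ, Poly.eval sp s = Poly.eval lp ((R : ℝ) + s))
    (h1 : ∀ a ∈ Poly.add sp [-ε], (0 : ℚ) ≤ a)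
    {u : ℝ} (hu : (R : ℝ) ≤ u) : 0 ≤ Poly.eval lp u + Real.exp (-u) * Poly.eval lq u := by
  have hR' : (1 : ℝ) ≤ R := by exact_mod_cast hR
  have hRpos : (0 : ℝ) < (R : ℝ) ^ N := pow_pos (by linarith) N
  have hs : 0 ≤ u - R := sub_nonneg.2 hu
  have hp : (ε : ℝ) ≤ Poly.eval lp u := by
    have h := poly_eval_nonneg_of_forall_mem_nonneg _ h1 hs
    rw [Poly.eval_add, hsp, add_sub_cancel, Poly.eval_cons, Poly.eval_nil] at h
    push_cast at h
    linarith
  have hq : |Real.exp (-u) * Poly.eval lq u| ≤ ε := by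
    rw [abs_mul, abs_of_pos (Real.exp_pos _)]
    have h1' := abs_poly_eval_le_eval_map_abs lq (by linarith : (0 : ℝ) ≤ u)
    have h2' := exp_neg_mul_eval_map_abs_le lq hN hR' hu
    have hε' : (N.factorial : ℝ) * Poly.eval (lq.map fun a => |a|) R / R ^ N ≤ ε := by
      rw [div_le_iff₀ hRpos, ← Poly.eval_evalQ]
      exact_mod_cast hε
    calc Real.exp (-u) * |Poly.eval lq u| ≤ Real.exp (-u) * Poly.eval (lq.map fun a => |a|) u :=
          mul_le_mul_of_nonneg_left h1' (Real.exp_pos _).le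
      _ ≤ ε := h2'.trans hε'
  have := neg_abs_le (Real.exp (-u) * Poly.eval lq u)
  linarith

end Literature.Analysis.ValidatedNumerics

end
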